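import Literature.Geometry.Riemannian.PinchingEstimatesMinimisers
import Mathlib.LinearAlgebra.Matrix.DotProduct
import HarnessLib

/-!
# The Frobenius bound for two vectors by an orthonormal pair
(topic `Geometry/Riemannian`)

Pointwise linear algebra for the ODE parts of Hamilton 1997, Thms. 1.3–1.4 (decomposition of
`Literature.Geometry.Riemannian.hamilton_chenZhu_pinching`, `PinchingEstimates.lean`). In
Hamilton's proof of Thm. 1.4 (p. 8) the `B`-terms of `d/dt (a₂ + a₃)` are estimated by
`b₂² + b₃² ≤ (b₂ + b₃)²`; in the tree's variational language (`b₂ + b₃` is the maximum of the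
Ky Fan bilinear sum `u₁ᵀBv₁ + u₂ᵀBv₂` over pairs of orthonormal 2-frames,
`HamiltonODE.SingularValuesSumSqLE`) the corresponding elementary fact is PROVED here:

* `exists_unit_perp_perp` — any two vectors of `ℝ³` have a common unit normal;
* `exists_pair_normSq_le_sq` — for `p, q ∈ ℝ³` there is an orthonormal pair `(v₁, v₂)` with
  `|p|² + |q|² ≤ (p·v₁ + q·v₂)²` (in an orthonormal basis `(e₁, e₂)` of a plane containing
  `p, q`, the two rotated/reflected frames realise `√((P₁ ± Q₂)² + (P₂ ∓ Q₁)²)`, whose squares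
  add up to `2(|p|² + |q|²)`);
* `exists_pair_mulTranspose_le_sq` — hence `|ᵗBu|² + |ᵗBv|² ≤ (uᵀBv₁ + vᵀBv₂)²` for some
  orthonormal `(v₁, v₂)`: the variational `b₂² + b₃² ≤ (b₂ + b₃)²` at the frame `(u, v)`.

## References

* R. S. Hamilton, Comm. Anal. Geom. 5 (1997), §2.1, Thm. 1.4 (proof, p. 8). [Hamilton1997]
-/

noncomputable section

open Set Real
open scoped Matrix BigOperators

namespace Literature.Geometry.Riemannian

namespace HamiltonODE

/-- Normalising a nonzero vector of `ℝ³`. [folklore] -/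
theorem normalize_dot_self {x : Fin 3 → ℝ} (hx : x ≠ 0) :
    ((x ⬝ᵥ x)⁻¹.sqrt • x) ⬝ᵥ ((x ⬝ᵥ x)⁻¹.sqrt • x) = 1 := by
  have hxx : 0 < x ⬝ᵥ x := lt_of_le_of_ne (Finset.sum_nonneg fun i _ ↦ mul_self_nonneg _)
    (fun h ↦ hx (dotProduct_self_eq_zero.1 h.symm))
  rw [dotProduct_smul, smul_dotProduct, smul_eq_mul, smul_eq_mul, Real.sqrt_inv, ← mul_assoc,
    ← mul_inv, Real.mul_self_sqrt hxx.le, inv_mul_cancel₀ hxx.ne']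

/-- **Any two vectors of `ℝ³` have a common unit normal.** [folklore] -/
theorem exists_unit_perp_perp (p q : Fin 3 → ℝ) :
    ∃ n : Fin 3 → ℝ, n ⬝ᵥ n = 1 ∧ n ⬝ᵥ p = 0 ∧ n ⬝ᵥ q = 0 := by
  by_cases hpq : p ⨯₃ q ≠ 0
  · refine ⟨((p ⨯₃ q) ⬝ᵥ (p ⨯₃ q))⁻¹.sqrt • (p ⨯₃ q), normalize_dot_self hpq, ?_, ?_⟩
    · rw [smul_dotProduct, dotProduct_comm (p ⨯₃ q) p, dot_self_cross, smul_zero]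
    · rw [smul_dotProduct, dotProduct_comm (p ⨯₃ q) q, dot_cross_self, smul_zero]
  rw [not_ne_iff] at hpq
  by_cases hp : p ≠ 0
  · obtain ⟨y, -, hy, -, hpy, -, -⟩ := exists_orthonormal_complement (normalize_dot_self hp)
    have hpp : 0 < p ⬝ᵥ p := lt_of_le_of_ne (Finset.sum_nonneg fun i _ ↦ mul_self_nonneg _)
      (fun h ↦ hp (dotProduct_self_eq_zero.1 h.symm))
    have hc : (p ⬝ᵥ p)⁻¹.sqrt ≠ 0 := (Real.sqrt_pos.2 (inv_pos.2 hpp)).ne'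
    rw [smul_dotProduct, smul_eq_mul, mul_eq_zero] at hpy
    have hpy' : p ⬝ᵥ y = 0 := hpy.resolve_left hc
    refine ⟨y, hy, by rw [dotProduct_comm]; exact hpy', ?_⟩
    -- `(p × q) × y = (p·y) q - (q·y) p = -(q·y) p`, and `p × q = 0`
    have h := cross_cross_eq_smul_sub_smul p q y
    rw [hpq, hpy', zero_smul, zero_sub] at h
    have h' : (q ⬝ᵥ y) • p = 0 := by
      have : (0 : Fin 3 → ℝ) ⨯₃ y = 0 := by simp
      rw [this] at h
      exact neg_eq_zero.1 h.symm
    rcases smul_eq_zero.1 h' with h0 | h0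
    · rw [dotProduct_comm]; exact h0
    · exact absurd h0 hp
  rw [not_ne_iff] at hp
  subst hp
  by_cases hq : q ≠ 0
  · obtain ⟨y, -, hy, -, hqy, -, -⟩ := exists_orthonormal_complement (normalize_dot_self hq)
    have hqq : 0 < q ⬝ᵥ q := lt_of_le_of_ne (Finset.sum_nonneg fun i _ ↦ mul_self_nonneg _)
      (fun h ↦ hq (dotProduct_self_eq_zero.1 h.symm))
    have hc : (q ⬝ᵥ q)⁻¹.sqrt ≠ 0 := (Real.sqrt_pos.2 (inv_pos.2 hqq)).ne'
    rw [smul_dotProduct, smul_eq_mul, mul_eq_zero] at hqy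
    exact ⟨y, hy, by simp, by rw [dotProduct_comm]; exact hqy.resolve_left hc⟩
  rw [not_ne_iff] at hq
  subst hq
  exact ⟨![1, 0, 0], by simp [dotProduct, Fin.sum_univ_three], by simp, by simp⟩

/-- A rotated (`σ = 1`) or reflected (`σ = -1`) frame of an orthonormal pair is orthonormal.
[folklore] -/
theorem rotate_orthonormal {e₁ e₂ : Fin 3 → ℝ} (h₁ : e₁ ⬝ᵥ e₁ = 1) (h₂ : e₂ ⬝ᵥ e₂ = 1)
    (h₁₂ : e₁ ⬝ᵥ e₂ = 0) {c s σ : ℝ} (hcs : c ^ 2 + s ^ 2 = 1) (hσ : σ ^ 2 = 1) :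
    (c • e₁ + s • e₂) ⬝ᵥ (c • e₁ + s • e₂) = 1 ∧
      ((-(σ * s)) • e₁ + (σ * c) • e₂) ⬝ᵥ ((-(σ * s)) • e₁ + (σ * c) • e₂) = 1 ∧
      (c • e₁ + s • e₂) ⬝ᵥ ((-(σ * s)) • e₁ + (σ * c) • e₂) = 0 := by
  have h₂₁ : e₂ ⬝ᵥ e₁ = 0 := by rw [dotProduct_comm]; exact h₁₂
  simp only [dotProduct_add, add_dotProduct, dotProduct_smul, smul_dotProduct, smul_eq_mul, h₁, h₂,
    h₁₂, h₂₁]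
  refine ⟨by nlinarith, ?_, by ring⟩
  have : (σ * s) ^ 2 + (σ * c) ^ 2 = 1 := by nlinarith
  nlinarith

/-- The planar computation: for reals `P₁, P₂, Q₁, Q₂` there are `σ = ±1` and a unit vector
`(c, s)` with `P₁² + P₂² + Q₁² + Q₂² ≤ (c(P₁ + σQ₂) + s(P₂ - σQ₁))²` (the two choices of `σ`
realise `(P₁ ± Q₂)² + (P₂ ∓ Q₁)²`, which add up to twice the left side). [folklore] -/
theorem exists_rotation_sq_ge (P₁ P₂ Q₁ Q₂ : ℝ) : ∃ σ c s : ℝ, σ ^ 2 = 1 ∧ c ^ 2 + s ^ 2 = 1 ∧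
    P₁ ^ 2 + P₂ ^ 2 + Q₁ ^ 2 + Q₂ ^ 2 ≤ (c * (P₁ + σ * Q₂) + s * (P₂ - σ * Q₁)) ^ 2 := by
  -- choose the sign with the larger `R² = (P₁ + σQ₂)² + (P₂ - σQ₁)²`
  obtain ⟨σ, hσ, hR⟩ : ∃ σ : ℝ, σ ^ 2 = 1 ∧
      P₁ ^ 2 + P₂ ^ 2 + Q₁ ^ 2 + Q₂ ^ 2 ≤ (P₁ + σ * Q₂) ^ 2 + (P₂ - σ * Q₁) ^ 2 := by
    rcases le_total ((P₁ - Q₂) ^ 2 + (P₂ + Q₁) ^ 2) ((P₁ + Q₂) ^ 2 + (P₂ - Q₁) ^ 2) with h | h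
    · exact ⟨1, by norm_num, by nlinarith⟩
    · exact ⟨-1, by norm_num, by nlinarith⟩
  set R2 := (P₁ + σ * Q₂) ^ 2 + (P₂ - σ * Q₁) ^ 2 with hR2
  have hR2nn : 0 ≤ R2 := by positivity
  rcases hR2nn.eq_or_lt with h0 | hpos
  · refine ⟨σ, 1, 0, hσ, by norm_num, ?_⟩
    nlinarith [sq_nonneg (1 * (P₁ + σ * Q₂) + 0 * (P₂ - σ * Q₁))]
  · set R := R2.sqrt with hRdef
    have hRR : R ^ 2 = R2 := Real.sq_sqrt hR2nn
    have hRpos : 0 < R := Real.sqrt_pos.2 hpos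
    refine ⟨σ, (P₁ + σ * Q₂) / R, (P₂ - σ * Q₁) / R, hσ, ?_, ?_⟩
    · rw [div_pow, div_pow, ← add_div, ← hR2, ← hRR, div_self (pow_ne_zero 2 hRpos.ne')]
    · have hval : (P₁ + σ * Q₂) / R * (P₁ + σ * Q₂) + (P₂ - σ * Q₁) / R * (P₂ - σ * Q₁) = R := by
        rw [div_mul_eq_mul_div, div_mul_eq_mul_div, ← add_div, div_eq_iff hRpos.ne']
        nlinarith [hRR]
      rw [hval, hRR]
      exact hR

/-- **The Frobenius bound by an orthonormal pair**: for `p, q ∈ ℝ³` there is an orthonormal pair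
`(v₁, v₂)` with `|p|² + |q|² ≤ (p·v₁ + q·v₂)²`. [folklore] -/
theorem exists_pair_normSq_le_sq (p q : Fin 3 → ℝ) :
    ∃ v₁ v₂ : Fin 3 → ℝ, v₁ ⬝ᵥ v₁ = 1 ∧ v₂ ⬝ᵥ v₂ = 1 ∧ v₁ ⬝ᵥ v₂ = 0 ∧
      p ⬝ᵥ p + q ⬝ᵥ q ≤ (p ⬝ᵥ v₁ + q ⬝ᵥ v₂) ^ 2 := by
  obtain ⟨n, hn, hnp, hnq⟩ := exists_unit_perp_perp p q
  obtain ⟨e₁, e₂, h₁, h₂, hn₁, hn₂, h₁₂⟩ := exists_orthonormal_complement hn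
  have he₁n : e₁ ⬝ᵥ n = 0 := by rw [dotProduct_comm]; exact hn₁
  have he₂n : e₂ ⬝ᵥ n = 0 := by rw [dotProduct_comm]; exact hn₂
  -- coordinates in the plane: `|p|² = P₁² + P₂²`, `|q|² = Q₁² + Q₂²`
  have hp := parseval_of_orthonormal h₁ h₂ hn h₁₂ he₁n he₂n p
  have hq := parseval_of_orthonormal h₁ h₂ hn h₁₂ he₁n he₂n q
  rw [hnp] at hp
  rw [hnq] at hq
  obtain ⟨σ, c, s, hσ, hcs, hineq⟩ := exists_rotation_sq_ge (e₁ ⬝ᵥ p) (e₂ ⬝ᵥ p) (e₁ ⬝ᵥ q) (e₂ ⬝ᵥ q)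
  obtain ⟨hv₁, hv₂, hv₁₂⟩ := rotate_orthonormal h₁ h₂ h₁₂ hcs hσ
  refine ⟨c • e₁ + s • e₂, (-(σ * s)) • e₁ + (σ * c) • e₂, hv₁, hv₂, hv₁₂, ?_⟩
  have hval : p ⬝ᵥ (c • e₁ + s • e₂) + q ⬝ᵥ ((-(σ * s)) • e₁ + (σ * c) • e₂) =
      c * (e₁ ⬝ᵥ p + σ * (e₂ ⬝ᵥ q)) + s * (e₂ ⬝ᵥ p - σ * (e₁ ⬝ᵥ q)) := by
    rw [dotProduct_comm p, dotProduct_comm q]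
    simp only [add_dotProduct, smul_dotProduct, smul_eq_mul]
    ring
  rw [hval, hp, hq]
  nlinarith [hineq]

/-- **`b₂² + b₃² ≤ (b₂ + b₃)²` at a frame**: for any `B` and vectors `u, v` there is an
orthonormal pair `(v₁, v₂)` with `|ᵗBu|² + |ᵗBv|² ≤ (uᵀBv₁ + vᵀBv₂)²`.
[cite: Hamilton1997, §2.1, Thm. 1.4 (proof, p. 8)] -/
theorem exists_pair_mulTranspose_le_sq (B : Matrix (Fin 3) (Fin 3) ℝ) (u v : Fin 3 → ℝ) :
    ∃ v₁ v₂ : Fin 3 → ℝ, v₁ ⬝ᵥ v₁ = 1 ∧ v₂ ⬝ᵥ v₂ = 1 ∧ v₁ ⬝ᵥ v₂ = 0 ∧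
      (Bᵀ *ᵥ u) ⬝ᵥ (Bᵀ *ᵥ u) + (Bᵀ *ᵥ v) ⬝ᵥ (Bᵀ *ᵥ v) ≤ (u ⬝ᵥ (B *ᵥ v₁) + v ⬝ᵥ (B *ᵥ v₂)) ^ 2 := by
  obtain ⟨v₁, v₂, h₁, h₂, h₁₂, h⟩ := exists_pair_normSq_le_sq (Bᵀ *ᵥ u) (Bᵀ *ᵥ v)
  refine ⟨v₁, v₂, h₁, h₂, h₁₂, ?_⟩
  rwa [Matrix.dotProduct_mulVec u B v₁, Matrix.dotProduct_mulVec v B v₂, ← Matrix.mulVec_transpose,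
    ← Matrix.mulVec_transpose]

end HamiltonODE

end Literature.Geometry.Riemannian

end
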